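import Summits.BirchSwinnertonDyer.Rank1Residual.X11a.PrintDischargeKimDeep
import Summits.BirchSwinnertonDyer.Rank1Residual.X11b.ChaPairs1
import Summits.BirchSwinnertonDyer.Rank1Residual.Supersingular.IntModelMinimalityKrausTwoMore
import Summits.BirchSwinnertonDyer.Rank1Residual.X11b.CertificateCheckBridge
import HarnessLib

/-!
# Class X11a, surjective leaf, Tamagawa-defect pairs: per-pair DEEP Kurihara-number records (Kim 2026
# Thm. 1.8 (6) beyond the unit case), file 1 — `375440db1 @ 5` (cell `bsd-print-x11a`, seat p1 g3)

HONEST FRAMING (cells `b2b-bsdres` / `bsd-print-x11a`, verbatim): the goal is to DELETE the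
COMBINATION-SHAPED residual classes of the Birch–Swinnerton-Dyer formula for ALL analytic-rank
`≤ 1` elliptic curves over `ℚ` — "full BSD formula for every rank `≤ 1` curve in class `C`"
assembled STRICTLY from published theorems — so that the rank-`≤ 1` remainder becomes exactly the
CONSTRUCTION-SHAPED classes, which are TYPED (missing-input `Prop`s), NOT attempted. This is not
"finishing BSD". PER PAIR: theorems only, no definition, no named fact; nothing is booked by this
file and no class label changes (referee / planner; two engines + REF per cell rules). The
CLASS-level lower half (crux `PrintX11a.X11aLowerHalf` = item stmt-BirchSwinnertonDyer-19064) stays OPEN.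

## What

The door `ClassX11a.missingLowerBoundAt_of_kimDeep_of_nonsplit` / `.bsdp_of_kimDeep_of_localTorsionTrivial`
(`X11a/PrintDischargeKimDeep.lean`, p548893: Kim, Amer. J. Math. 148 (2026) Thm. 1.8 (6) BEYOND THE
UNIT CASE, tree fact `Kim2026.rankZero_le_padicValNat_sha_of_kuriharaNumber_ne_zero_of_localTorsionTrivial`,
proof-covered `(t0)` twin) at the pair `375440db1 @ 5` — one of the ten surjective leaf pairs of
X11a with `N < 5·10⁵` still open per pair in the route text (`Theses/PrintX11a.lean`), with
TAMAGAWA DEFECT (`∏ c_ℓ = 10`, `c₁₃ = 5`: the unit-Kurihara door `Typed.X11RankZero.bsdp_of_kim_…`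
is empty there by Kim's Conjecture 1.10) — fed by the level-`2` certificate of kit job j285781
(seat p1 g3, engine `kur2`: the ν = 2 assembly of b2b-bsdres x11a gen 12 `an3.py` VERBATIM + a numpy
multiplicative `a_n` sieve read modulo `p²`; validated byte-identically against the kurihara lane's
implementation 1 through the tree's `X11a/KimRecords1.lean` — 17640l1@5, `n = 13231`, `δ = 1`,
symSha256 `5ee09ab2a830db50…`; `n = 40501`, `δ = 3`, `b770d9d1e8f6504e…` — and against PARI `ellan`,
0 mismatches on `2·10⁷` coefficients):

  `n = 1887751 = 1301 · 1451`, both `ℓ ∈ 𝒫₂` (`ℓ ≡ 1`, `a_ℓ ≡ ℓ + 1 (mod 25)`: `a₁₃₀₁ = −23`,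
  `a₁₄₅₁ = 27`), `Ẽ(𝔽_ℓ)` cyclic of orders `1325`, `1425` (so `#Ẽ(𝔽_ℓ)[5] = 5`), least primitive
  roots `η = 2, 2`, common denominator `D = 2`, `942500` symbols, table sha256
  `997069123c7957539d7df1f4a3767ffb5e6d1c5d96c84aa892947bb099d178bf`, and
  **`δ̃_n ≡ 10 (mod 25)`** — `≡ 0 (mod 5)` as forced by `dim Sel₅ = 2` and the defect, `≢ 0 (mod 25)`:
  `ord₅ δ̃_n = 1 = ∂^{(∞)}`; `[0]⁺ = L(E,1)/Ω = 250 = 2·5³`.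

KERNEL (as in p4's `X11a/ChaRecords*.lean`): `Δ ≠ 0` (elliptic), global minimality (Kraus, complete
factorisation `|Δ| = 2⁸·5⁴·13⁵·19¹⁰`), `5 ∣ Δ ∧ 5 ∤ c₄` (multiplicative at `5`), `E[5]` irreducible by
the Frobenius witness `#Ẽ(𝔽₇) = 4` (`a₇ = 4`, `X² − 4X + 7` root-free mod `5`; Mazur 1978 Prop. 6.3 (1)),
`ord₅ ∏ c_ℓ ≥ 1` from the displayed `∏ c_ℓ = 10`. DISPLAYED (Cremona `allcurves`/`allbsd`/`galrep` and the
certificate; exactly the door's binders): `r_an = 0`; no (ram) prime (`¬ Ram W 5`: the other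
multiplicative prime `13` has `v₁₃(Δ) = 5`); `ρ̄_{E,5}` onto; NON-split at `5` (`a₅ = −1`; the `(t0)`
disjunct); `∏ c_ℓ = 10`; a modular parametrisation datum `D` with `5 ∤ c_D` (`375440db1` is the
`X₀(N)`-optimal curve of its class and `25 ∤ N = 2⁴·5·13·19²`: Mazur 1978 Cor. 4.1); the Kolyvagin
level `n = 1887751 ∈ 𝒩₂` with cyclic reductions; surjective discrete logarithms `ψ ↠ ℤ/25`; and the
certificate `kuriharaNumber D.f 25 1887751 ψ ≠ 0`. Theorems: `mlb5_c375440db1`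
(`Typed.MissingLowerBoundAt W 5` = crux 19064's currency at the pair) and `bsdp5_c375440db1`
(`BSDp W 5`, with Wuthrich 2014 Prop. 21 for the Euler half). Evidence: seat folder
`kit/RESULTS-375440db1.md` (attached to item 19064), job outputs `compute/j285781/outputs/`
(`records.jsonl`, `symbols_375440db1_1887751.txt.gz`), HOME/P1-ROAD.md §8, HOME/STATUS.md.

References: [Kim2022StructureSelmer] Thm. 1.9 (6) (= journal Thm. 1.8 (6)), §1.5.1, Conj. 1.10;
[Mazur1978] Prop. 6.3 (1), Cor. 4.1; [Wuthrich2014] Prop. 21; [Miller2011LMS] Def. 1.1;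
[SilvermanAEC2009] VII.1 Rem. 1.1, VII.5.1; [Kraus1989]; [Cremona2006] (label 375440db1).
-/

set_option autoImplicit false

noncomputable section

open scoped Classical

open WeierstrassCurve Literature.NumberTheory.EllipticCurves
  Literature.NumberTheory.EllipticCurves.ModularForms
  Literature.NumberTheory.EllipticCurves.Rank1Residual
  Literature.NumberTheory.EllipticCurves.Rank1Residual.Typed
  Literature.NumberTheory.EllipticCurves.Rank1Residual.X11RankOneCertificates
  Literature.NumberTheory.EllipticCurves.Wuthrich2014
  NumberField IsDedekindDomain Rat.HeightOneSpectrum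
  Summit.BirchSwinnertonDyer.BirchSwinnertonDyer.Rank1Residual.IntModel
  Summit.BirchSwinnertonDyer.BirchSwinnertonDyer.Rank1Residual.X11RankOne
  Summit.BirchSwinnertonDyer.Rank1Residual.Supersingular

namespace Summit.BirchSwinnertonDyer.Rank1Residual.X11a.KimDeepRecords

/-! ### `375440db1 @ 5` (`N = 375440 = 2⁴·5·13·19²`, `ρ̄_{E,5}` onto, non-split multiplicative at `5`,
`∏ c_ℓ = 10` (`c₁₃ = 5`), `#E(ℚ)_tors = 1`, `#Ш_an = 25`) -/

/-- `375440db1 = [0, -1, 0, -20373516, -45774812020]` is globally minimal: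
`|Δ| = 2⁸·5⁴·13⁵·19¹⁰` (kernel) + Kraus (every exponent `< 12`).
[cite: SilvermanAEC2009, VII.1 Remark 1.1] [cite: Kraus1989, Prop. 1 and Prop. 2] -/
theorem isGloballyMinimal_c375440db1 :
    (⟨0, -1, 0, -20373516, -45774812020⟩ : WeierstrassCurve ℚ).IsGloballyMinimal :=
  isGloballyMinimal_of_krausCriterion₃_factored 0 (-1) 0 (-20373516) (-45774812020)
    [(2, 8), (5, 4), (13, 5), (19, 10)] (by decide +kernel)
    (by intro qe hqe; simp only [List.mem_cons, List.not_mem_nil, or_false] at hqe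
        rcases hqe with rfl | rfl | rfl | rfl <;> norm_num)
    (by intro qe hqe; simp only [List.mem_cons, List.not_mem_nil, or_false] at hqe
        rcases hqe with rfl | rfl | rfl | rfl
        · exact Or.inl (by decide +kernel)
        · exact Or.inl (by decide +kernel)
        · exact Or.inl (by decide +kernel)
        · exact Or.inl (by decide +kernel))

/-- `375440db1` is an elliptic curve: `Δ = −2⁸·5⁴·13⁵·19¹⁰ ≠ 0` (kernel). [folklore] -/
theorem isElliptic_c375440db1 :
    (⟨0, -1, 0, -20373516, -45774812020⟩ : WeierstrassCurve ℚ).IsElliptic :=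
  X11b.isElliptic_of_discOf_ne_zero 0 (-1) 0 (-20373516) (-45774812020) (by decide +kernel)

/-- `#Ẽ(𝔽₇) = 4` for `375440db1` (`a₇ = 4`; `X² − 4X + 7` is root-free mod `5`: the Frobenius
irreducibility witness, kernel count `countPoints`). [folklore] -/
theorem card_c375440db1_7 :
    Nat.card (((⟨0, -1, 0, -20373516, -45774812020⟩ : WeierstrassCurve ℤ).map
      (Int.castRingHom (ZMod 7))).toAffine.Point) = 4 := by
  have h := X11b.natCard_point_eq_countPoints 0 (-1) 0 (-20373516) (-45774812020) 7 (by norm_num)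
    (by decide +kernel)
  have h' : countPoints [0, -1, 0, -20373516, -45774812020] 7 = 4 := by decide +kernel
  exact_mod_cast h.trans h'

/-- **`375440db1 @ 5`: the LOWER half `ord₅ #Ш_an ≤ ord₅ #Ш`** (`Typed.MissingLowerBoundAt W 5`, the
currency of crux `X11aLowerHalf` = item 19064, at this pair) from the DEEP Kurihara certificate of kit
job j285781 (`δ̃_{1301·1451} ≡ 10 (mod 25)`, level `k = 2 ≤ ord₅ ∏ c_ℓ + 1`) through the door
`ClassX11a.missingLowerBoundAt_of_kimDeep_of_nonsplit` (Kim 2026 Thm. 1.8 (6) beyond the unit case,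
proof-covered `(t0)` twin `hKim0`; period transfer `hϖ`; GZK; modularity `hmod`). KERNEL (instances supplied by `isElliptic_c375440db1`,
`isGloballyMinimal_c375440db1`): multiplicative at `5`, `E[5]` irreducible (`card_c375440db1_7`), `ord₅ ∏ c_ℓ ≥ 1`
from `htam`. DISPLAYED: `r_an = 0`, `¬ Ram`, `ρ̄` onto, non-split at `5`, `∏ c_ℓ = 10`, the datum `D`
with `5 ∤ c_D` (optimal curve, Mazur Cor. 4.1), `n = 1887751 ∈ 𝒩₂` with cyclic reductions
(`#Ẽ(𝔽₁₃₀₁) = 1325`, `#Ẽ(𝔽₁₄₅₁) = 1425`, cyclic), `ψ ↠ ℤ/25`, and the certificate. PER PAIR; nothing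
booked (second engine + REF pending). [cite: Kim2022StructureSelmer, Thm. 1.9 (6) (PDF p. 8) and §1.5.1]
[cite: Mazur1978, §6 Prop. 6.3 (1) (p. 153) and Cor. 4.1] [cite: Miller2011LMS, Def. 1.1]
[cite: Cremona2006, Table 1 (Cremona label 375440db1)] -/
theorem mlb5_c375440db1
    (hKim0 : Kim2026.rankZero_le_padicValNat_sha_of_kuriharaNumber_ne_zero_of_localTorsionTrivial)
    (hϖ : realPeriodRat_eq_unit_mul_plusPeriod_of_multiplicative)
    (hGZK : rank_eq_analyticRank_of_analyticRank_le_one) (hmod : hasEntireLFunction_rat)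
    (W : WeierstrassCurve ℚ) [W.IsElliptic] [W.IsGloballyMinimal]
    (hW : W = ⟨0, -1, 0, -20373516, -45774812020⟩) (hr : W.analyticRank = 0) (hnram : ¬ Ram W 5) (hsurj : Surj W 5)
    (hns : ¬ W.HasSplitMultiplicativeReductionAtPrime 5) (htam : W.tamagawaProduct = 10)
    {N : ℕ} [NeZero N] (D : ModularParametrizationData W N) (hc : ¬ (5 : ℤ) ∣ D.maninConstant)
    (hn : Kato.IsKolyvaginProduct W 5 2 1887751)
    (hcyc : ∀ (ℓ : ℕ) [Fact ℓ.Prime], ℓ ∣ 1887751 →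
      Nat.card {P : ((WeierstrassCurve.integralModelInt W).map
          (Int.castRingHom (ZMod ℓ))).toAffine.Point // 5 • P = 0} ≤ 5)
    (ψ : (ℓ : ℕ) → (ZMod ℓ)ˣ →* Multiplicative (ZMod (5 ^ 2)))
    (hψ : ∀ ℓ ∈ (1887751 : ℕ).primeFactors, Function.Surjective (ψ ℓ))
    (hδ : kuriharaNumber D.f (5 ^ 2) 1887751 ψ ≠ 0) : MissingLowerBoundAt W 5 := by
  haveI : Fact (Nat.Prime 5) := ⟨by norm_num⟩
  haveI : Fact (Nat.Prime 7) := ⟨by norm_num⟩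
  haveI : NeZero (1887751 : ℕ) := ⟨by norm_num⟩
  have hI' : integralModelInt W = ⟨0, -1, 0, -20373516, -45774812020⟩ := by
    subst hW; exact integralModelInt_eq_of_map_eq _ (map_mk_int 0 (-1) 0 (-20373516) (-45774812020))
  have hmult : Mult W 5 :=
    hasMultiplicativeReductionAtPrime_of_intModel hI' 5 (by decide +kernel) (by decide +kernel)
  have hirr : Irr W 5 :=
    hasIrreducibleModPGaloisRep_of_intModel_of_noroot (hp := ⟨by norm_num⟩) (hℓ := ⟨by norm_num⟩)
      hI' 5 7 (by norm_num) (by decide +kernel) card_c375440db1_7 (by decide)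
  have hX : ClassX11a W 5 := ⟨hr, by norm_num, hmult, hirr, hnram⟩
  have hkc : 2 ≤ padicValNat 5 W.tamagawaProduct + 1 := by
    have h1 : 1 ≤ padicValNat 5 W.tamagawaProduct := by
      rw [htam]; exact one_le_padicValNat_of_dvd (by norm_num) (by norm_num)
    omega
  exact hX.missingLowerBoundAt_of_kimDeep_of_nonsplit hKim0 hϖ hGZK hmod le_rfl hsurj hns D hc
    2 1887751 (by norm_num) hkc hn hcyc ψ hψ hδ

/-- **`BSD(375440db1, 5)`** from the same certificate: the lower half of `mlb5_c375440db1` plus the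
Euler half at surjective image (Wuthrich 2014 Prop. 21, `hWu`), through
`ClassX11a.bsdp_of_kimDeep_of_localTorsionTrivial`. PER PAIR; nothing booked.
[cite: Wuthrich2014, Prop. 21 (p. 400)] [cite: Kim2022StructureSelmer, Thm. 1.9 (6) (PDF p. 8)]
[cite: Miller2011LMS, Def. 1.1] [cite: Cremona2006, Table 1 (Cremona label 375440db1)] -/
theorem bsdp5_c375440db1 (hWu : sha_dvd_analyticSha)
    (hKim0 : Kim2026.rankZero_le_padicValNat_sha_of_kuriharaNumber_ne_zero_of_localTorsionTrivial)
    (hϖ : realPeriodRat_eq_unit_mul_plusPeriod_of_multiplicative)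
    (hGZK : rank_eq_analyticRank_of_analyticRank_le_one) (hmod : hasEntireLFunction_rat)
    (W : WeierstrassCurve ℚ) [W.IsElliptic] [W.IsGloballyMinimal]
    (hW : W = ⟨0, -1, 0, -20373516, -45774812020⟩) (hr : W.analyticRank = 0) (hnram : ¬ Ram W 5) (hsurj : Surj W 5)
    (hns : ¬ W.HasSplitMultiplicativeReductionAtPrime 5) (htam : W.tamagawaProduct = 10)
    {N : ℕ} [NeZero N] (D : ModularParametrizationData W N) (hc : ¬ (5 : ℤ) ∣ D.maninConstant)
    (hn : Kato.IsKolyvaginProduct W 5 2 1887751)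
    (hcyc : ∀ (ℓ : ℕ) [Fact ℓ.Prime], ℓ ∣ 1887751 →
      Nat.card {P : ((WeierstrassCurve.integralModelInt W).map
          (Int.castRingHom (ZMod ℓ))).toAffine.Point // 5 • P = 0} ≤ 5)
    (ψ : (ℓ : ℕ) → (ZMod ℓ)ˣ →* Multiplicative (ZMod (5 ^ 2)))
    (hψ : ∀ ℓ ∈ (1887751 : ℕ).primeFactors, Function.Surjective (ψ ℓ))
    (hδ : kuriharaNumber D.f (5 ^ 2) 1887751 ψ ≠ 0) : BSDp W 5 := by
  haveI : Fact (Nat.Prime 5) := ⟨by norm_num⟩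
  haveI : Fact (Nat.Prime 7) := ⟨by norm_num⟩
  haveI : NeZero (1887751 : ℕ) := ⟨by norm_num⟩
  have hI' : integralModelInt W = ⟨0, -1, 0, -20373516, -45774812020⟩ := by
    subst hW; exact integralModelInt_eq_of_map_eq _ (map_mk_int 0 (-1) 0 (-20373516) (-45774812020))
  have hmult : Mult W 5 :=
    hasMultiplicativeReductionAtPrime_of_intModel hI' 5 (by decide +kernel) (by decide +kernel)
  have hirr : Irr W 5 :=
    hasIrreducibleModPGaloisRep_of_intModel_of_noroot (hp := ⟨by norm_num⟩) (hℓ := ⟨by norm_num⟩)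
      hI' 5 7 (by norm_num) (by decide +kernel) card_c375440db1_7 (by decide)
  have hX : ClassX11a W 5 := ⟨hr, by norm_num, hmult, hirr, hnram⟩
  have hkc : 2 ≤ padicValNat 5 W.tamagawaProduct + 1 := by
    have h1 : 1 ≤ padicValNat 5 W.tamagawaProduct := by
      rw [htam]; exact one_le_padicValNat_of_dvd (by norm_num) (by norm_num)
    omega
  exact hX.bsdp_of_kimDeep_of_localTorsionTrivial hWu hKim0 hϖ hGZK hmod le_rfl hsurj (Or.inl hns) D hc
    2 1887751 (by norm_num) hkc hn hcyc ψ hψ hδ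

end Summit.BirchSwinnertonDyer.Rank1Residual.X11a.KimDeepRecords

end
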